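import Literature.AlgebraicGeometry.GroupSchemes.KernelIdealSpecialFibre
import Literature.AlgebraicGeometry.GroupSchemes.EtaleHopfIdealsOfPoints
import HarnessLib

/-!
# A morphism out of a finite étale scheme kills a closed subscheme iff it kills its points
# ([StacksProject] 00U3; [Waterhouse1979] §2.1; [Tate1997FiniteFlatGroupSchemes] (3.7))

For `G` affine, finite ÉTALE over a separably closed field `k`, `G′` an affine `k`-group scheme, `φ : G → G′` any `k`-morphism and `J ⊂ Γ(G)`
any ideal: the closed subscheme `V(J) = Spec (Γ(G) ⧸ J) ↪ G` (★ `quotIncl`) is KILLED by `φ` (`quotIncl G J ≫ φ = 1`) iff every `k`-point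
`x` of `V(J)` (i.e. `J ≤ ker φ_x`) is killed (`x ≫ φ = 1`).  (`⇒`: points of `V(J)` factor through `quotIncl`, ★ `exists_comp_quotIncl_eq_iff_le_ker`;
`⇐`: ★ kills criterion `quotIncl_comp_eq_one_iff_map_ker_counit_le` + «an ideal of a finite étale scheme is the ideal of its points» ★
`EtaleIdealPoints.eq_ker_pi_ptEquiv_points` + `φ_{x ≫ φ} = φ_x ∘ Γ(φ)` ★ `ptEquiv_comp` + `φ_1 = η ∘ ε` ★ `ptEquiv_one`.)  The cell's (ρ1) KILL step
(hodgecm-mathlib, programme P6 «MOD», crux hLiu418 = stmt-HodgeConjecture-24832): the generic layer `A_y[𝔭](Ω̄)` is étale, so «the roof kills the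
points of the line `L`» ⇒ «the roof kills `V(I_L)`», which ★ (O-K) `quotIncl_spI_comp_eq_one` then specialises.  THEOREMS ONLY (no definition, no
instance, no notation, no named fact, no `sorry`); `--supports stmt-HodgeConjecture-24832`, count-neutral.

## References
* [StacksProject] The Stacks Project, Tag 00U3 (étale algebras over fields: points separate).
* [Waterhouse1979] W. C. Waterhouse, *Introduction to Affine Group Schemes*, GTM 66 (1979), §2.1 (p. 14) (closed subgroups and Hopf ideals; the augmentation ideal).
* [Tate1997FiniteFlatGroupSchemes] J. Tate, *Finite flat group schemes*, in: Modular Forms and Fermat's Last Theorem (1997), (3.7) (étale group schemes and their points).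
-/

set_option autoImplicit false

set_option backward.isDefEq.respectTransparency false

universe u

open CategoryTheory CategoryTheory.Limits AlgebraicGeometry MonoidalCategory CartesianMonoidalCategory

noncomputable section

namespace Literature.AlgebraicGeometry.GroupSchemes

namespace AffineGroupScheme

open scoped MonObj CategoryTheory.Obj

open Literature.AlgebraicGeometry.Motives

variable {k : Type u} [Field k] {G G' : SchemeOver k} [IsAffine G.left] [GrpObj G'] [IsAffine G'.left] (φ : G ⟶ G') (J : Ideal (Alg G))

omit [IsAffine G'.left] in
/-- **POINTS OF `V(J)` ARE KILLED WHEN `V(J)` IS** (any field, no étaleness): if `quotIncl G J ≫ φ = 1` then every `k`-point `x` of `G` with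
`J ≤ ker φ_x` satisfies `x ≫ φ = 1` (★ `exists_comp_quotIncl_eq_iff_le_ker`). [cite: Waterhouse1979, §2.1 (p. 14)] -/
theorem comp_eq_one_of_quotIncl_comp_eq_one (h : quotIncl G J ≫ φ = 1) (x : Motives.specOver k k ⟶ G)
    (hx : J ≤ RingHom.ker (ptEquiv G k x).toRingHom) : x ≫ φ = 1 := by
  obtain ⟨v, hv⟩ := (exists_comp_quotIncl_eq_iff_le_ker G J x).mpr hx
  rw [← hv, Category.assoc, h, MonObj.comp_one]

/-- The algebra map of a KILLED point annihilates the augmentation ideal: `x ≫ φ = 1` ⇒ `φ_x (Γ(φ) b) = 0` for `b ∈ ker ε_{G′}`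
(★ `ptEquiv_comp`, ★ `ptEquiv_one`). [cite: Waterhouse1979, §2.1 (p. 14)] -/
theorem ptEquiv_comap_eq_zero_of_comp_eq_one (x : Motives.specOver k k ⟶ G) (hx : x ≫ φ = 1) (b : Alg G')
    (hb : b ∈ RingHom.ker (Bialgebra.counitAlgHom k (Alg G'))) : ptEquiv G k x (Alg.comap φ b) = 0 := by
  have h1 : ptEquiv G k x (Alg.comap φ b) = ptEquiv G' k (x ≫ φ) b := by
    rw [ptEquiv_comp, AlgHom.comp_apply]
  rw [h1, hx, ptEquiv_one, AlgHom.comp_apply]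
  rw [RingHom.mem_ker] at hb
  rw [hb, map_zero]

variable [IsSepClosed k] [Etale G.hom]

/-- **HEAD — A FINITE ÉTALE CLOSED SUBSCHEME IS KILLED IFF ITS POINTS ARE**: for `G` affine étale over a separably closed field (finite is not needed: ★ `eq_ker_pi_ptEquiv_points`), `G′` an
affine group scheme, `φ : G → G′` and an ideal `J ⊂ Γ(G)`: `quotIncl G J ≫ φ = 1 ↔ ∀ x ∈ G(k), J ≤ ker φ_x → x ≫ φ = 1`.
[cite: StacksProject, Tag 00U3] [cite: Waterhouse1979, §2.1 (p. 14)] [cite: Tate1997FiniteFlatGroupSchemes, (3.7)] -/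
theorem quotIncl_comp_eq_one_iff_forall_points :
    quotIncl G J ≫ φ = 1 ↔ ∀ x : Motives.specOver k k ⟶ G, J ≤ RingHom.ker (ptEquiv G k x).toRingHom → x ≫ φ = 1 := by
  refine ⟨fun h x hx => comp_eq_one_of_quotIncl_comp_eq_one φ J h x hx, fun h => ?_⟩
  rw [quotIncl_comp_eq_one_iff_map_ker_counit_le, Ideal.map_le_iff_le_comap]
  intro b hb
  rw [Ideal.mem_comap, EtaleIdealPoints.eq_ker_pi_ptEquiv_points G J, RingHom.mem_ker]
  funext x
  exact ptEquiv_comap_eq_zero_of_comp_eq_one φ x.1 (h x.1 x.2) b hb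

omit [IsSepClosed k] [Etale G.hom] [IsAffine G'.left] in
/-- **SUBGROUP-OF-POINTS FORM** (any field): if `V(J)` is killed by `φ` then so is every point of a subgroup `H ≤ G(k)` whose points lie on `V(J)`
(`∀ x ∈ H, J ≤ ker φ_x`) — the shape in which the cell's lines `L ≤ A_y(Ω̄)` are read. [cite: Tate1997FiniteFlatGroupSchemes, (3.7)] -/
theorem forall_comp_eq_one_of_quotIncl_comp_eq_one [GrpObj G] (H : Subgroup (Motives.specOver k k ⟶ G))
    (hH : ∀ x ∈ H, J ≤ RingHom.ker (ptEquiv G k x).toRingHom) (h : quotIncl G J ≫ φ = 1) :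
    ∀ x ∈ H, x ≫ φ = 1 := fun x hx =>
  comp_eq_one_of_quotIncl_comp_eq_one φ J h x (hH x hx)

/-- **POINTS-OF-`V(J)` FORM OF THE HEAD**: with `V(J)(k) = {x | J ≤ ker φ_x}` characterised by membership in a set `S` (`hS`), `V(J)` is killed iff
every point of `S` is. [cite: StacksProject, Tag 00U3] [cite: Tate1997FiniteFlatGroupSchemes, (3.7)] -/
theorem quotIncl_comp_eq_one_iff_forall_mem (S : Set (Motives.specOver k k ⟶ G))
    (hS : ∀ x : Motives.specOver k k ⟶ G, J ≤ RingHom.ker (ptEquiv G k x).toRingHom ↔ x ∈ S) :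
    quotIncl G J ≫ φ = 1 ↔ ∀ x ∈ S, x ≫ φ = 1 := by
  rw [quotIncl_comp_eq_one_iff_forall_points]
  exact ⟨fun h x hx => h x ((hS x).mpr hx), fun h x hx => h x ((hS x).mp hx)⟩

end AffineGroupScheme

end Literature.AlgebraicGeometry.GroupSchemes

end
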